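/-
Copyright: the b2b-balaban T⁴-continuum CRUX team, row NE7b, leaf lineage `t4-ne7b-formalise-leaf-03` (gen 139). Project licence.
-/
import Mathlib.Algebra.Order.Field.GeomSum
import Literature.Probability.LatticeModels.LatticeAnimalsGraph
import Summits.QuantumFields.BalabanUV.T4Continuum.Spine.NE7b.LocalPerturbationSandwich

/-!
# (R2′) IN PRINT'S CURRENCY, I: the per-site norm `Σ_{X ∋ i} w_X ≤ C₀` of the OWNER's sandwich FROM a tree-decay letter
# `w_X ≤ A·ρ^{#X−1}` on connected supports — entropy (lattice animals) × decay is lattice-free — and the OWNER's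
# `perturbedMoment_le_of_localTerms` with `hnorm` DISCHARGED: factor `e^{2·#n₁·A∕(1−Δ²ρ)}` (row NE7b, node U5c; [folklore])

Cell `pub-balaban`, sub-cell `t4`, spine estimate NE7b (`T4WeightBudget.RelWeightBound`; the cell's OWN estimate — NOT PRINTED in
[Bałaban 1983–89], NOT PROVED).  Crux-route work under `Spine/NE7b/` (FREEZE (0) crux-prover clause): [folklore] finite sums over
Mathlib, the tree's lattice-animal bound and the OWNER's `…LocalPerturbationSandwich` BY NAME; NOTHING of Bałaban's is named, valued
or asserted; no `T4Continuum/Support` leaf typed; no `def`; zero `sorry`.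

WHY.  `…NE7b.LocalPerturbationSandwich.perturbedMoment_le_of_localTerms` (OWNER g106) reduced the non-Gaussian small-field remainder
(R2) to (R2′): sup bounds `|E_X| ≤ w_X` of the local terms with a PER-SITE norm `hnorm : Σ_{X ∋ i} w_X ≤ C₀` at every near coordinate,
price `e^{2·#n₁·C₀}`.  Print's letter is not a per-site norm but a TREE-DECAY bound on localization domains,
`|E(X)| ≤ O(1)·e^{−κ d_k(X)}` ([Balaban1989LargeFieldI] §1), «summable per cube by the tree-decay norm» (crux refuter F388 (b)).
The conversion is ENTROPY × DECAY: connected `(m+1)`-sets through a site are at most `Δ^{2m}` when degrees are `≤ Δ` (the tree's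
`Literature.Probability.LatticeModels.card_le_pow_of_isGraphConnected`, Friedli–Velenik (5.27)), so a decay `A·ρ^{#X−1}` with `Δ²ρ < 1`
sums to `A∕(1−Δ²ρ)` at EVERY site — a constant that sees neither the lattice nor the family.  (The companion
`…NE7b.LocalTermsOnCubes` counts the near block in CUBES instead of coordinates — the refuter's ROOM clause F388 (a).)

WHAT IS PROVED ([folklore]):
* §1 GRADED SUMS: `sum_le_sum_card_fiber_mul` (`f a ≤ w (g a)` ⟹ `Σ_{a ∈ 𝒜} f a ≤ Σ_m #{g = m}·w m`),
  **`sum_le_geometric_of_count_mul_decay`** (`#{a ∈ 𝒜 : g a = m} ≤ N m`, `N m·w m ≤ A·θᵐ`, `0 ≤ θ < 1`, grades `≥ R` ⟹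
  `Σ_{a ∈ 𝒜} f a ≤ A·θ^R∕(1−θ)` — sees neither `#𝒜` nor the top grade), `…₀` (`R = 0`).
* §2 POLYMERS: `card_connected_through_of_grade_le` (graded lattice-animal count), **`perSiteNorm_le_of_treeDecay`** (`𝒳` a family of
  `G`-connected sets, degrees `≤ Δ`, `w_X ≤ A·ρ^{#X−1}`, `Δ²ρ < 1` ⟹ `Σ_{X ∈ 𝒳, X ∋ i} w_X ≤ A∕(1−Δ²ρ)` at EVERY site — the letter `hnorm`
  with `C₀ := A∕(1−Δ²ρ)`), `treeDecay_of_expDecay` (print's form `A·e^{−κ d(X)}`, tree length `d(X) ≥ #X − 1` ⟹ `ρ = e^{−κ}`; summable once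
  `κ > 2 log Δ`), `treeDecay_of_expDecay_affine` (v2: print's `d_j(X)` = shortest tree INTERSECTING the cubes of a CONNECTED family,
  [Balaban1987RGApproachI] (0.24)–(0.26) — affine comparison `#X ≤ a·d(X) + b` ⟹ `ρ = e^{−κ∕a}`, constant `A·e^{κb∕a}`), a toy
  `example` (the letters jointly inhabited).
* §3 JUNCTION: **`perturbedMoment_le_of_treeDecay`** (= the OWNER's `perturbedMoment_le_of_localTerms` BY NAME with `hnorm` DISCHARGED
  by §2 on a coordinate graph: factor `e^{2·#n₁·A∕(1−Δ²ρ)}` — print's «exp O(1)|Z ∩ Ω|» ([Balaban1989LargeFieldII] p. 383 l. 21–28)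
  IN KIND with the O(1) a function of the decay letter `(A, ρ, Δ)` alone).
NOT HERE (honest): that Bałaban's localization domains and effective actions SUPPLY `(A, κ)` with `κ > 2 log Δ` uniformly in the
running coupling, the adjacency `Δ` and the sup bounds on the small-field support — the (A1c) INSTANCE's reading of
[Balaban1989LargeFieldI] §1 (NC-NE7b-α UNRULED); the MAIN action's anharmonic family (refuter F388 (a): by value, not a polymer
decay); the support clause of `hw` (refuter Q-ne7bref-g67-1); the volume-free BUFFER of (R1″) (leaf-02 `…InducedMeanLatticeGrowth` —
not touched here); (A3); anything of Bałaban's.  BY-NAME EFFECT ON THE WALL: NONE.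
NE7b NOT PRINTED ∕ NOT PROVED; spine PROVED 0∕9; rung (B)+1 on ONE finite T⁴ — NOT infinite volume, NOT the mass gap, NOT Clay.
HONEST DEPENDENCY: continuum YM on T⁴ ⇐ BetaPertH ∧ nine spine estimates (0∕9 proved); BetaPertH ⇐ (D1) ∧ (D4) ∧ CAP+tail.
-/

set_option autoImplicit false

open Matrix Finset Real MeasureTheory
open Summit.QuantumFields.BalabanUV.T4Continuum.NE7b.LocalPerturbationSandwich

namespace Summit.QuantumFields.BalabanUV.T4Continuum.NE7b.LocalTermsTreeDecay

/-! ## §1 Graded finite sums: entropy × decay -/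

section Graded

variable {α : Type*}

/-- **BINNING BY GRADE**: if `f a ≤ w (g a)` on `𝒜` and all grades are `≤ M`, then `Σ_{a ∈ 𝒜} f a ≤ Σ_{m ≤ M} #{a ∈ 𝒜 : g a = m}·w m`.
[folklore] -/
theorem sum_le_sum_card_fiber_mul (𝒜 : Finset α) (g : α → ℕ) (f : α → ℝ) (w : ℕ → ℝ)
    (hf : ∀ a ∈ 𝒜, f a ≤ w (g a)) {M : ℕ} (hM : ∀ a ∈ 𝒜, g a ≤ M) :
    ∑ a ∈ 𝒜, f a ≤ ∑ m ∈ range (M + 1), ((𝒜.filter fun a => g a = m).card : ℝ) * w m := by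
  calc ∑ a ∈ 𝒜, f a ≤ ∑ a ∈ 𝒜, w (g a) := sum_le_sum hf
    _ = ∑ m ∈ range (M + 1), ∑ a ∈ 𝒜 with g a = m, w m :=
        (sum_fiberwise_of_maps_to' (fun a ha => mem_range.2 (Nat.lt_succ_of_le (hM a ha))) w).symm
    _ = ∑ m ∈ range (M + 1), ((𝒜.filter fun a => g a = m).card : ℝ) * w m :=
        sum_congr rfl fun m _ => by rw [sum_const, nsmul_eq_mul]

/-- **ENTROPY × DECAY ⟹ GEOMETRIC, VOLUME-FREE.**  `f a ≤ w (g a)` with `w ≥ 0`; at most `N m` members of grade `m`;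
`N m·w m ≤ A·θᵐ` with `A ≥ 0`, `0 ≤ θ < 1`; every grade on `𝒜` is `≥ R`.  Then `Σ_{a ∈ 𝒜} f a ≤ A·θ^R∕(1 − θ)` — a bound that sees
neither `#𝒜` nor the top grade. [folklore] -/
theorem sum_le_geometric_of_count_mul_decay (𝒜 : Finset α) (g : α → ℕ) (f : α → ℝ) (w N : ℕ → ℝ)
    (hf : ∀ a ∈ 𝒜, f a ≤ w (g a)) (hw0 : ∀ m, 0 ≤ w m)
    (hN : ∀ m, ((𝒜.filter fun a => g a = m).card : ℝ) ≤ N m)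
    {A θ : ℝ} (hA : 0 ≤ A) (hθ0 : 0 ≤ θ) (hθ1 : θ < 1) (hNw : ∀ m, N m * w m ≤ A * θ ^ m)
    {R : ℕ} (hR : ∀ a ∈ 𝒜, R ≤ g a) :
    ∑ a ∈ 𝒜, f a ≤ A * θ ^ R / (1 - θ) := by
  have hM : ∀ a ∈ 𝒜, g a ≤ 𝒜.sup g := fun a ha => le_sup (f := g) ha
  refine (sum_le_sum_card_fiber_mul 𝒜 g f w hf hM).trans ?_
  have hterm : ∀ m ∈ range (𝒜.sup g + 1),
      ((𝒜.filter fun a => g a = m).card : ℝ) * w m ≤ if R ≤ m then A * θ ^ m else 0 := by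
    intro m _
    split_ifs with h
    · exact (mul_le_mul_of_nonneg_right (hN m) (hw0 m)).trans (hNw m)
    · have he : (𝒜.filter fun a => g a = m) = ∅ :=
        filter_eq_empty_iff.2 fun a ha hga => h (hga ▸ hR a ha)
      rw [he, card_empty, Nat.cast_zero, zero_mul]
  refine (sum_le_sum hterm).trans ?_
  rw [← sum_filter]
  have hsub : (range (𝒜.sup g + 1)).filter (fun m => R ≤ m) ⊆ Ico R (𝒜.sup g + 1) := fun m hm => by
    rw [mem_filter, mem_range] at hm
    exact mem_Ico.2 ⟨hm.2, hm.1⟩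
  calc ∑ m ∈ (range (𝒜.sup g + 1)).filter (fun m => R ≤ m), A * θ ^ m
      ≤ ∑ m ∈ Ico R (𝒜.sup g + 1), A * θ ^ m :=
        sum_le_sum_of_subset_of_nonneg hsub fun m _ _ => mul_nonneg hA (pow_nonneg hθ0 m)
    _ = A * ∑ m ∈ Ico R (𝒜.sup g + 1), θ ^ m := by rw [mul_sum]
    _ ≤ A * (θ ^ R / (1 - θ)) := mul_le_mul_of_nonneg_left (geom_sum_Ico_le_of_lt_one hθ0 hθ1) hA
    _ = A * θ ^ R / (1 - θ) := by ring

/-- The same without a buffer (`R = 0`): `Σ_{a ∈ 𝒜} f a ≤ A∕(1 − θ)`. [folklore] -/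
theorem sum_le_geometric_of_count_mul_decay₀ (𝒜 : Finset α) (g : α → ℕ) (f : α → ℝ) (w N : ℕ → ℝ)
    (hf : ∀ a ∈ 𝒜, f a ≤ w (g a)) (hw0 : ∀ m, 0 ≤ w m)
    (hN : ∀ m, ((𝒜.filter fun a => g a = m).card : ℝ) ≤ N m)
    {A θ : ℝ} (hA : 0 ≤ A) (hθ0 : 0 ≤ θ) (hθ1 : θ < 1) (hNw : ∀ m, N m * w m ≤ A * θ ^ m) :
    ∑ a ∈ 𝒜, f a ≤ A / (1 - θ) := by
  have h := sum_le_geometric_of_count_mul_decay 𝒜 g f w N hf hw0 hN hA hθ0 hθ1 hNw (R := 0) fun a _ => Nat.zero_le _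
  rwa [pow_zero, mul_one] at h

end Graded

/-! ## §2 Connected polymers through a site: the per-site norm from a tree-decay letter -/

section Polymers

open Literature.Probability.LatticeModels

variable {V : Type*} [Fintype V] [DecidableEq V] (G : SimpleGraph V) [DecidableRel G.Adj]

/-- **ENTROPY OF CONNECTED POLYMERS** (the tree's lattice-animal bound, graded): among `G`-connected sets through the site `i`,
those with `#X − 1 = m` number at most `Δ^{2m}` when all degrees are `≤ Δ`. [folklore] -/
theorem card_connected_through_of_grade_le {Δ : ℕ} (hΔ : ∀ x, G.degree x ≤ Δ) (𝒳 : Finset (Finset V))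
    (hconn : ∀ X ∈ 𝒳, IsGraphConnected G X) (i : V) (m : ℕ) :
    ((((𝒳.filter fun X => i ∈ X).filter fun X => X.card - 1 = m).card : ℕ) : ℝ) ≤ (Δ : ℝ) ^ (2 * m) := by
  have h := card_le_pow_of_isGraphConnected hΔ (v := i) (n := m + 1)
    ((𝒳.filter fun X => i ∈ X).filter fun X => X.card - 1 = m) fun S hS => by
      obtain ⟨hS1, hS2⟩ := mem_filter.1 hS
      obtain ⟨hS𝒳, hiS⟩ := mem_filter.1 hS1
      refine ⟨hiS, ?_, hconn S hS𝒳⟩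
      have : 1 ≤ S.card := card_pos.2 ⟨i, hiS⟩
      omega
  rw [Nat.add_sub_cancel] at h
  exact_mod_cast h

/-- **THE PER-SITE NORM FROM TREE DECAY.**  A family `𝒳` of `G`-connected finite sets (degrees `≤ Δ`) with weights
`w_X ≤ A·ρ^{#X − 1}` (`A ≥ 0`, `ρ ≥ 0`) and `Δ²ρ < 1`: at EVERY site `i`, `Σ_{X ∈ 𝒳, X ∋ i} w_X ≤ A∕(1 − Δ²ρ)` — the letter `hnorm`
of `…LocalPerturbationSandwich.perturbedMoment_le_of_localTerms` with `C₀ := A∕(1 − Δ²ρ)`, free of the lattice and of `#𝒳`.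
[folklore] -/
theorem perSiteNorm_le_of_treeDecay {Δ : ℕ} (hΔ : ∀ x, G.degree x ≤ Δ) (𝒳 : Finset (Finset V))
    (hconn : ∀ X ∈ 𝒳, IsGraphConnected G X) (w : Finset V → ℝ) {A ρ : ℝ} (hA : 0 ≤ A) (hρ0 : 0 ≤ ρ)
    (hρ : (Δ : ℝ) ^ 2 * ρ < 1) (hw : ∀ X ∈ 𝒳, w X ≤ A * ρ ^ (X.card - 1)) (i : V) :
    ∑ X ∈ 𝒳.filter (fun X => i ∈ X), w X ≤ A / (1 - (Δ : ℝ) ^ 2 * ρ) :=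
  sum_le_geometric_of_count_mul_decay₀ (𝒳.filter fun X => i ∈ X) (fun X => X.card - 1) w
    (fun m => A * ρ ^ m) (fun m => (Δ : ℝ) ^ (2 * m))
    (fun X hX => hw X (mem_filter.1 hX).1) (fun m => mul_nonneg hA (pow_nonneg hρ0 m))
    (card_connected_through_of_grade_le G hΔ 𝒳 hconn i) hA (mul_nonneg (pow_nonneg (Nat.cast_nonneg Δ) 2) hρ0) hρ
    fun m => le_of_eq (by rw [mul_pow, ← pow_mul]; ring)

omit [Fintype V] [DecidableEq V] in
/-- **PRINT'S FORM OF THE LETTER**: a decay `w_X ≤ A·e^{−κ·d(X)}` (`κ ≥ 0`) in a tree length `d(X) ≥ #X − 1` is the tree-decay letter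
with `ρ = e^{−κ}` (summable by `perSiteNorm_le_of_treeDecay` once `Δ²e^{−κ} < 1`, i.e. `κ > 2 log Δ`). [folklore] -/
theorem treeDecay_of_expDecay (𝒳 : Finset (Finset V)) (w dX : Finset V → ℝ) {A κ : ℝ} (hA : 0 ≤ A) (hκ : 0 ≤ κ)
    (hd : ∀ X ∈ 𝒳, ((X.card - 1 : ℕ) : ℝ) ≤ dX X) (hw : ∀ X ∈ 𝒳, w X ≤ A * exp (-(κ * dX X))) :
    ∀ X ∈ 𝒳, w X ≤ A * exp (-κ) ^ (X.card - 1) := fun X hX =>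
  (hw X hX).trans (mul_le_mul_of_nonneg_left (by
    rw [← exp_nat_mul, mul_neg, ← neg_mul, ← mul_comm]
    exact exp_le_exp.2 (by nlinarith [hd X hX, mul_le_mul_of_nonneg_left (hd X hX) hκ])) hA)

omit [Fintype V] [DecidableEq V] in
/-- **PRINT'S FORM OF THE LETTER, AFFINE READING** (v2).  In [Balaban1987RGApproachI] p. 256–257 a localization domain `X` is a
CONNECTED family of `M`-cubes (consecutive cubes sharing a `(d−1)`-face — so the cube graph has degrees `≤ 2d`) and `d_j(X)` is the
length, in units of `M`, of a shortest tree graph INTERSECTING every cube of `X` ((0.24)–(0.26): `|E^{(j)}(X)| ≤ E₀·e^{−κ d_j(X)}` and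
`Σ_{X ∋ □} E₀e^{−κ d_j(X)} ≤ E₀·O(1)`, USED there without proof).  Such a tree may be much shorter than `#X − 1` (cubes around a common
vertex), so the comparison of record between the grade `#X` and print's `d_j` is AFFINE, `#X ≤ a·d(X) + b` with `a > 0` (a traversal
of the tree cut into unit pieces gives e.g. `a = 2^{d+1}`, `b = 2^d` — a reading, not proved here).  Under it the decay
`w_X ≤ A·e^{−κ·d(X)}` (`A, κ ≥ 0`) is the tree-decay letter with `ρ = e^{−κ∕a}` and constant `A·e^{κb∕a}`; summable by
`perSiteNorm_le_of_treeDecay` once `Δ²e^{−κ∕a} < 1` — print's «sufficiently large `κ`» ((0.25); `d_j` is measured in units of `M`).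
(`treeDecay_of_expDecay` = the case `a = b = 1`, with the sharper constant `A`.) [folklore] -/
theorem treeDecay_of_expDecay_affine (𝒳 : Finset (Finset V)) (w dX : Finset V → ℝ) {A κ a b : ℝ} (hA : 0 ≤ A) (hκ : 0 ≤ κ)
    (ha : 0 < a) (hd : ∀ X ∈ 𝒳, (X.card : ℝ) ≤ a * dX X + b) (hw : ∀ X ∈ 𝒳, w X ≤ A * exp (-(κ * dX X))) :
    ∀ X ∈ 𝒳, w X ≤ (A * exp (κ * b / a)) * exp (-(κ / a)) ^ (X.card - 1) := by
  intro X hX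
  refine (hw X hX).trans ?_
  rw [mul_assoc, ← exp_nat_mul, ← exp_add]
  refine mul_le_mul_of_nonneg_left (exp_le_exp.2 ?_) hA
  have h1 : (((X.card - 1 : ℕ) : ℕ) : ℝ) ≤ (X.card : ℝ) := by exact_mod_cast Nat.sub_le _ _
  have h2 : κ / a * (X.card : ℝ) ≤ κ / a * (a * dX X + b) := mul_le_mul_of_nonneg_left (hd X hX) (div_nonneg hκ ha.le)
  have h3 : κ / a * (a * dX X + b) = κ * dX X + κ * b / a := by field_simp
  have h4 : 0 ≤ κ / a := div_nonneg hκ ha.le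
  nlinarith [mul_le_mul_of_nonneg_left h1 h4]

/-- Toy (non-vacuity of §2's letters): on the edgeless graph over `Fin 2` (`Δ = 0`) the connected sets through `0` in
`𝒳 = {{0}, {1}}` weigh `1 ≤ A∕(1 − Δ²ρ) = 1` with `A = 1`, `ρ = 1∕2`. -/
example : ∑ X ∈ ({{0}, {1}} : Finset (Finset (Fin 2))).filter (fun X => (0 : Fin 2) ∈ X), (fun _ => (1 : ℝ)) X ≤
    1 / (1 - ((0 : ℕ) : ℝ) ^ 2 * (1 / 2)) := by
  refine perSiteNorm_le_of_treeDecay (⊥ : SimpleGraph (Fin 2)) (Δ := 0) (fun x => ?_) _ (fun X hX => ?_) _ zero_le_one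
    (by norm_num) (by norm_num) (fun X hX => ?_) 0
  · simp
  · simp only [Finset.mem_insert, Finset.mem_singleton] at hX
    rcases hX with rfl | rfl <;> exact isGraphConnected_singleton (G := ⊥) _
  · simp only [Finset.mem_insert, Finset.mem_singleton] at hX
    rcases hX with rfl | rfl <;> simp

end Polymers

/-! ## §3 Junction: the OWNER's sandwich with `hnorm` discharged by the tree-decay letter -/

section Junctions

open Literature.Probability.LatticeModels

variable {n₁ n₂ : Type} [Fintype n₁] [Fintype n₂] [DecidableEq n₁] [DecidableEq n₂]

/-- **(R2) FROM A TREE-DECAY LETTER, COORDINATE FORM** = the OWNER's `…LocalPerturbationSandwich.perturbedMoment_le_of_localTerms`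
BY NAME with its per-site norm `hnorm` DISCHARGED by `perSiteNorm_le_of_treeDecay`: local terms on `G`-connected coordinate sets
(degrees `≤ Δ`), sup bounds `|E_X| ≤ w_X` on the small-field support for the terms touching the near block, the letter
`0 ≤ w_X ≤ A·ρ^{#X−1}` with `Δ²ρ < 1`, and the UNPERTURBED fibre hypothesis `hfib` (constant `C ≥ 0`) ⟹
`∫ F₁F₂·e^{Q₁⊕0}·e^{−S}·e^{−V} ≤ e^{2·#n₁·A∕(1−Δ²ρ)}·C·∫ F₁F₂·e^{−S}·e^{−V}`. [folklore] -/
theorem perturbedMoment_le_of_treeDecay (S₁₁ Q₁ : Matrix n₁ n₁ ℝ) (S₁₂ : Matrix n₁ n₂ ℝ) (S₂₂ : Matrix n₂ n₂ ℝ)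
    (F₁ : (n₁ → ℝ) → ℝ) (F₂ : (n₂ → ℝ) → ℝ) (𝒳 : Finset (Finset (n₁ ⊕ n₂)))
    (E : Finset (n₁ ⊕ n₂) → ((n₁ ⊕ n₂) → ℝ) → ℝ) (w : Finset (n₁ ⊕ n₂) → ℝ) {C : ℝ}
    (G : SimpleGraph (n₁ ⊕ n₂)) [DecidableRel G.Adj] {Δ : ℕ} (hΔ : ∀ x, G.degree x ≤ Δ)
    (hconn : ∀ X ∈ 𝒳, IsGraphConnected G X) {A ρ : ℝ} (hA : 0 ≤ A) (hρ0 : 0 ≤ ρ) (hρ : (Δ : ℝ) ^ 2 * ρ < 1)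
    (hF₁ : ∀ x₁, 0 ≤ F₁ x₁) (hF₂ : ∀ x₂, 0 ≤ F₂ x₂) (hC : 0 ≤ C)
    (hloc : ∀ X ∈ 𝒳, ∀ x y : (n₁ ⊕ n₂) → ℝ, (∀ i ∈ X, x i = y i) → E X x = E X y)
    (hw : ∀ X ∈ 𝒳, (∃ i : n₁, Sum.inl i ∈ X) → ∀ x : (n₁ ⊕ n₂) → ℝ,
      F₁ (fun i => x (Sum.inl i)) ≠ 0 → F₂ (fun i => x (Sum.inr i)) ≠ 0 → |E X x| ≤ w X)
    (hw0 : ∀ X ∈ 𝒳, 0 ≤ w X) (hwdec : ∀ X ∈ 𝒳, w X ≤ A * ρ ^ (X.card - 1))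
    (hA' : Integrable fun x : n₁ ⊕ n₂ → ℝ =>
      (F₁ (fun i => x (Sum.inl i)) * (F₂ (fun i => x (Sum.inr i)) *
        exp (-(∑ X ∈ 𝒳.filter (fun X => ¬ ∃ i : n₁, Sum.inl i ∈ X), E X (Sum.elim 0 fun j => x (Sum.inr j)))))) *
        (exp (x ⬝ᵥ (Matrix.fromBlocks Q₁ 0 0 (0 : Matrix n₂ n₂ ℝ) *ᵥ x)) *
          exp (-(x ⬝ᵥ (Matrix.fromBlocks S₁₁ S₁₂ S₁₂ᵀ S₂₂ *ᵥ x)))))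
    (hB : Integrable fun x : n₁ ⊕ n₂ → ℝ =>
      (F₁ (fun i => x (Sum.inl i)) * (F₂ (fun i => x (Sum.inr i)) *
        exp (-(∑ X ∈ 𝒳.filter (fun X => ¬ ∃ i : n₁, Sum.inl i ∈ X), E X (Sum.elim 0 fun j => x (Sum.inr j)))))) *
        exp (-(x ⬝ᵥ (Matrix.fromBlocks S₁₁ S₁₂ S₁₂ᵀ S₂₂ *ᵥ x))))
    (hB' : Integrable fun x : n₁ ⊕ n₂ → ℝ => (F₁ (fun i => x (Sum.inl i)) * F₂ (fun i => x (Sum.inr i))) *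
      (exp (-(x ⬝ᵥ (Matrix.fromBlocks S₁₁ S₁₂ S₁₂ᵀ S₂₂ *ᵥ x))) * exp (-(∑ X ∈ 𝒳, E X x))))
    (hfib : ∀ x₂, F₂ x₂ ≠ 0 →
      ∫ x₁, F₁ x₁ * (exp (x₁ ⬝ᵥ (Q₁ *ᵥ x₁)) * exp (-(x₁ ⬝ᵥ (S₁₁ *ᵥ x₁) + 2 * (x₁ ⬝ᵥ (S₁₂ *ᵥ x₂))))) ≤
        C * ∫ x₁, F₁ x₁ * exp (-(x₁ ⬝ᵥ (S₁₁ *ᵥ x₁) + 2 * (x₁ ⬝ᵥ (S₁₂ *ᵥ x₂))))) :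
    ∫ x : n₁ ⊕ n₂ → ℝ, (F₁ (fun i => x (Sum.inl i)) * F₂ (fun i => x (Sum.inr i))) *
        ((exp (x ⬝ᵥ (Matrix.fromBlocks Q₁ 0 0 (0 : Matrix n₂ n₂ ℝ) *ᵥ x)) *
          exp (-(x ⬝ᵥ (Matrix.fromBlocks S₁₁ S₁₂ S₁₂ᵀ S₂₂ *ᵥ x)))) * exp (-(∑ X ∈ 𝒳, E X x))) ≤
      (exp (2 * (Fintype.card n₁ * (A / (1 - (Δ : ℝ) ^ 2 * ρ)))) * C) *
        ∫ x : n₁ ⊕ n₂ → ℝ, (F₁ (fun i => x (Sum.inl i)) * F₂ (fun i => x (Sum.inr i))) *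
          (exp (-(x ⬝ᵥ (Matrix.fromBlocks S₁₁ S₁₂ S₁₂ᵀ S₂₂ *ᵥ x))) * exp (-(∑ X ∈ 𝒳, E X x))) :=
  perturbedMoment_le_of_localTerms S₁₁ Q₁ S₁₂ S₂₂ F₁ F₂ 𝒳 E w hF₁ hF₂ hC hloc hw hw0
    (fun i => perSiteNorm_le_of_treeDecay G hΔ 𝒳 hconn w hA hρ0 hρ hwdec (Sum.inl i)) hA' hB hB' hfib

end Junctions

end Summit.QuantumFields.BalabanUV.T4Continuum.NE7b.LocalTermsTreeDecay
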